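import Mathlib
import HarnessLib

/-!
# Crux `EulerZoomLiouville.PowerGaugeEulerLiouville` (stmt-NavierStokesRegularity-19832), nsreg-p2 ROUND-56 «THE LOGARITHM'S PRICE», plate t60-LOGLEMMA:
# THE LOG LEMMA (tail integral `∫_{s>l} s^{−(p+1)} log s ds` in closed form, beside `TwoSidedMoment.exists_limit_of_deriv_bound`)

Seat ns-ezl-w1 g9 (`--supports stmt-NavierStokesRegularity-19832 --as helper`; planner nsreg-p2 g45's ROUND-56 §10 / v1.1 R4 key, 2026-08-29).
VERBATIM port of `r56/Sketch56.lean` (sha16 caee30280605acd0, author nsreg-p2 g45) §L — the integral form of the logarithmic majorant of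
`WeakTrace.exists_limit_of_deriv_bound_log` (p-port `…WeakTraceLog`), for a hand who prefers `integral_Ioi_of_hasDerivAt_of_tendsto` to the sandwich:

* `TwoSidedMoment.logTailPrim p s = −s^{−p}(p log s + 1)/p²` — the antiderivative of `s^{−(p+1)} log s`
  (`hasDerivAt_logTailPrim`, `tendsto_logTailPrim_atTop`);
* `TwoSidedMoment.integral_Ioi_rpow_neg_mul_log_eq` — `∫_{s>l} s^{−(p+1)} log s ds = l^{−p}(p log l + 1)/p²` (`0 < p`, `1 ≤ l`);
* `TwoSidedMoment.integral_Ioi_rpow_neg_mul_log_le` — the working bound `∫_{s>l} s^{−(3+ρ)} log s ds ≤ ((3+ρ)/(2+ρ)²) l^{−(2+ρ)} (1 + log l)` (`−2 < ρ`, `1 ≤ l`).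

HONEST FRAMING: real-variable calculus; nothing about the crux E (19832 OPEN) or NS regularity; not E.
-/

noncomputable section

-- flat `Theorems/<Route><Decl>…` files of one crux share the namespace of the crux (tree convention)
set_option linter.dupNamespace false

open MeasureTheory Set Filter Topology Metric Function TopologicalSpace
open scoped ENNReal NNReal Topology

namespace Summit.NavierStokesRegularity.NavierStokesRegularity.Theorems.PowerGaugeEulerLiouville.TwoSidedMoment

/-- The antiderivative `F(s) = −s^{−p}(p log s + 1)/p²` of `s^{−(p+1)} log s`. -/
def logTailPrim (p s : ℝ) : ℝ := -(s ^ (-p) * (p * Real.log s + 1)) / p ^ 2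

/-- `F′(s) = s^{−(p+1)} log s` for `s > 0` (`p ≠ 0`). -/
theorem hasDerivAt_logTailPrim {p s : ℝ} (hp : p ≠ 0) (hs : 0 < s) :
    HasDerivAt (logTailPrim p) (s ^ (-(p + 1)) * Real.log s) s := by
  have h1 : HasDerivAt (fun x : ℝ => x ^ (-p)) (-p * s ^ (-p - 1)) s :=
    Real.hasDerivAt_rpow_const (Or.inl hs.ne')
  have h2 : HasDerivAt (fun x : ℝ => p * Real.log x + 1) (p * s⁻¹) s := by
    simpa using ((Real.hasDerivAt_log hs.ne').const_mul p).add_const 1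
  have h3 : HasDerivAt (fun x : ℝ => -(x ^ (-p) * (p * Real.log x + 1)) / p ^ 2)
      (-((-p * s ^ (-p - 1)) * (p * Real.log s + 1) + s ^ (-p) * (p * s⁻¹)) / p ^ 2) s :=
    ((h1.mul h2).neg).div_const (p ^ 2)
  have he : -p - 1 = -(p + 1) := by ring
  have hsplit : s ^ (-p) * (p * s⁻¹) = p * s ^ (-(p + 1)) := by
    rw [← he, Real.rpow_sub_one hs.ne', div_eq_mul_inv]; ring
  show HasDerivAt (fun x : ℝ => -(x ^ (-p) * (p * Real.log x + 1)) / p ^ 2) (s ^ (-(p + 1)) * Real.log s) s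
  refine h3.congr_deriv ?_
  rw [hsplit, he]
  field_simp
  ring

/-- `F(s) → 0` as `s → ∞` (`0 < p`). -/
theorem tendsto_logTailPrim_atTop {p : ℝ} (hp : 0 < p) :
    Tendsto (logTailPrim p) atTop (𝓝 0) := by
  have h1 : Tendsto (fun s : ℝ => Real.log s / s ^ p) atTop (𝓝 0) :=
    (isLittleO_log_rpow_atTop hp).tendsto_div_nhds_zero
  have h2 : Tendsto (fun s : ℝ => s ^ (-p)) atTop (𝓝 0) := tendsto_rpow_neg_atTop hp
  have h3 : Tendsto (fun s : ℝ => -((p * (Real.log s / s ^ p) + s ^ (-p))) / p ^ 2) atTop (𝓝 (-((p * 0 + 0)) / p ^ 2)) :=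
    ((h1.const_mul p).add h2).neg.div_const _
  simp only [mul_zero, add_zero, neg_zero, zero_div] at h3
  refine h3.congr' ?_
  filter_upwards [eventually_gt_atTop (0 : ℝ)] with s hs
  simp only [logTailPrim]
  rw [Real.rpow_neg hs.le, div_eq_mul_inv]
  ring

/-- **THE LOG LEMMA (exact value).**  For `0 < p` and `1 ≤ l`: `∫_{s > l} s^{−(p+1)} log s ds = l^{−p} (p log l + 1) / p²`. -/
theorem integral_Ioi_rpow_neg_mul_log_eq {p l : ℝ} (hp : 0 < p) (hl : 1 ≤ l) :
    ∫ s in Ioi l, s ^ (-(p + 1)) * Real.log s = l ^ (-p) * (p * Real.log l + 1) / p ^ 2 := by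
  have hl0 : 0 < l := lt_of_lt_of_le one_pos hl
  have hcont : ContinuousWithinAt (logTailPrim p) (Ici l) l :=
    (hasDerivAt_logTailPrim hp.ne' hl0).continuousAt.continuousWithinAt
  have hderiv : ∀ s ∈ Ioi l, HasDerivAt (logTailPrim p) (s ^ (-(p + 1)) * Real.log s) s :=
    fun s hs => hasDerivAt_logTailPrim hp.ne' (hl0.trans hs)
  have hnonneg : ∀ s ∈ Ioi l, 0 ≤ s ^ (-(p + 1)) * Real.log s := fun s hs =>
    mul_nonneg (Real.rpow_nonneg (hl0.trans hs).le _) (Real.log_nonneg (hl.trans (le_of_lt hs)))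
  have hint : IntegrableOn (fun s => s ^ (-(p + 1)) * Real.log s) (Ioi l) :=
    integrableOn_Ioi_deriv_of_nonneg hcont hderiv hnonneg (tendsto_logTailPrim_atTop hp)
  rw [integral_Ioi_of_hasDerivAt_of_tendsto hcont hderiv hint (tendsto_logTailPrim_atTop hp)]
  simp only [logTailPrim]
  ring

/-- **THE LOG LEMMA (working bound)** in the `ρ`-idiom: for `−2 < ρ` and `1 ≤ l`, `∫_{s > l} s^{−(3+ρ)} log s ds ≤ ((3+ρ)/(2+ρ)²)·l^{−(2+ρ)}·(1 + log l)`. -/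
theorem integral_Ioi_rpow_neg_mul_log_le {ρ l : ℝ} (hρ : -2 < ρ) (hl : 1 ≤ l) :
    ∫ s in Ioi l, s ^ (-(3 + ρ)) * Real.log s ≤ (3 + ρ) / (2 + ρ) ^ 2 * l ^ (-(2 + ρ)) * (1 + Real.log l) := by
  have hp : 0 < 2 + ρ := by linarith
  have h3 : -(3 + ρ) = -((2 + ρ) + 1) := by ring
  rw [h3, integral_Ioi_rpow_neg_mul_log_eq hp hl]
  have hl0 : 0 < l := lt_of_lt_of_le one_pos hl
  have hlog : 0 ≤ Real.log l := Real.log_nonneg hl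
  have hlp : 0 ≤ l ^ (-(2 + ρ)) := Real.rpow_nonneg hl0.le _
  rw [div_le_iff₀ (pow_pos hp 2)]
  have : (3 + ρ) / (2 + ρ) ^ 2 * l ^ (-(2 + ρ)) * (1 + Real.log l) * (2 + ρ) ^ 2
      = l ^ (-(2 + ρ)) * ((3 + ρ) * (1 + Real.log l)) := by
    field_simp
  rw [this]
  apply mul_le_mul_of_nonneg_left _ hlp
  nlinarith

end Summit.NavierStokesRegularity.NavierStokesRegularity.Theorems.PowerGaugeEulerLiouville.TwoSidedMoment

end
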